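import Literature.NumberTheory.DiophantineGeometry.CatalanPUnitsFree
import HarnessLib

/-!
# Coordinates of `p`-units modulo `q`-th powers [Schoof2009, Cor. 13.7 / Thm. 14.1 bookkeeping]

Let `p` be an odd prime, `K = ℚ(ζ_p)`, `π = ζ_p - 1`, `E = {ε π^m}` the `p`-units
(`Catalan.PUnits.punit`), `g = (p-1)/2`, and `q ∤ 2pg` a prime.  [Schoof2009, Proposition 13.7]
(tree: `Catalan.PUnits.exists_free_generator`) gives a generator `γ` of `(ℤ/p)ˣ` and a `p`-unit
`u = ε₀ π^{k₀}` such that the `σ_{γ^k}(u)`, `k ∈ ℤ/g`, form an `𝔽_q`-basis of `E/E^q`.  This file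
turns that statement into a **coordinate map** `crd : E → 𝔽_q^{ℤ/g}` (well defined modulo `q`-th
powers) and proves the properties by which the plus argument [Schoof2009, Theorem 14.1] uses the
`𝔽_q[G⁺]`-module `E/E^q`:

* `Catalan.Coord.exists_crd` — the package: `γ, ε₀, k₀` and `crd` with the representation property
  (every `ε π^m` is `∏_k σ_{γ^k}(u)^{crd_k} · (p`-unit`)^q`) and uniqueness modulo `q`;
* `crd_mul` — additivity; `crd_eq_zero_iff`-type statements (`crd = 0` iff `q`-th power of a `p`-unit);
* `crd_gal` — **the Galois action is the regular representation of `ℤ/g`**: `σ_{γ^j}` shifts the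
  coordinates by `j` (in particular `ι = σ_{-1} = σ_{γ^g}` acts trivially, [Schoof2009, Lemma 7.1 (ii)]);
* `crd_prod_gal` — every coordinate vector occurs.

All statements take the data `(γ, ε₀, k₀, crd)` and the two defining properties as parameters, so
that no definition is introduced (proofs file, D-0026).

## References

* R. Schoof, *Catalan's Conjecture*, Universitext, Springer 2009, Lemma 7.1, Proposition 13.7,
  Theorem 14.1 (book pp. 39, 89–93). [Schoof2009]
-/

namespace Literature.NumberTheory.DiophantineGeometry

namespace Catalan.Coord

open NumberField NumberField.Units Finset IsCyclotomicExtension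
open Literature.NumberTheory.NumberFields.Stickelberger Literature.NumberTheory.NumberFields.UnitGalois
open Catalan.PUnits Catalan.Minus

set_option backward.isDefEq.respectTransparency false
set_option maxSynthPendingDepth 3

variable {p : ℕ} [hp : Fact p.Prime] {K : Type*} [Field K] [NumberField K]
  [hK : IsCyclotomicExtension {p} ℚ K] {ζ : K} (hζ : IsPrimitiveRoot ζ p)

/-! ### `p`-units: `q`-th powers, conjugates, complex conjugation -/

/-- Products of powers of conjugates of `p`-units are `p`-units:
`∏_i σ_{a_i}(ε_i π^{m_i})^{c_i} = E π^M` explicitly. [cite: Schoof2009, Proposition 13.7 (proof)] -/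
theorem prod_gal_punit_pow {ι : Type*} (s : Finset ι) (a : ι → (ZMod p)ˣ) (ε : ι → (𝓞 K)ˣ)
    (m : ι → ℤ) (c : ι → ℕ) :
    ∏ i ∈ s, (gal p K (a i) (punit hζ (ε i) (m i))) ^ c i =
      punit hζ (∏ i ∈ s, (unitsGal (gal p K (a i)) (ε i) * uσ hζ (a i) ^ m i) ^ c i)
        (∑ i ∈ s, (c i : ℤ) * m i) := by
  rw [← punit_prod]
  refine Finset.prod_congr rfl fun i _ => ?_
  rw [gal_punit, punit_pow]

include hζ in
/-- **`ι = σ_{-1}` acts trivially on `E/E^q`** ([Schoof2009, Lemma 7.1 (ii)]): `ι(ε π^m) = ε π^m · t^q`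
for a root of unity `t` (which is a `q`-th power as `q` is prime to `2p`).
[cite: Schoof2009, Lemma 7.1 (ii)] -/
theorem exists_gal_neg_one_punit (hp2 : p ≠ 2) {q : ℕ} (hq : q.Coprime (2 * p)) (ε : (𝓞 K)ˣ)
    (m : ℤ) : ∃ t : (𝓞 K)ˣ, gal p K (-1) (punit hζ ε m) = punit hζ ε m * punit hζ t 0 ^ q := by
  -- `ι(ε) = t₁ ε` with `t₁` torsion, `u_{-1}` torsion
  have hcoord : coordU (unitsGal (gal p K (-1)) ε) = coordU ε := by
    rw [coordU_unitsGal, Amat_neg_one hζ hp2, Matrix.one_mulVec]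
  obtain ⟨t₁, ht₁, hε⟩ := exists_torsion_of_coordU_eq hcoord
  obtain ⟨s₁, hs₁⟩ := exists_pow_eq_of_mem_torsion hp2 hq ht₁
  obtain ⟨s₂, hs₂⟩ := exists_pow_eq_of_mem_torsion hp2 hq
    ((torsion K).zpow_mem (uσ_neg_one_mem_torsion hζ) m)
  refine ⟨s₁ * s₂, ?_⟩
  rw [gal_punit, hε, hs₁, hs₂, punit_pow, mul_zero, ← punit_mul, add_zero, mul_pow,
    mul_comm (s₁ ^ q) ε, mul_assoc]

include hζ in
/-- `σ_{±1}`-translates: `σ_{(-1)^t}(ε π^m) = ε π^m · (p`-unit`)^q`. [cite: Schoof2009, Lemma 7.1 (ii)] -/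
theorem exists_gal_neg_one_pow_punit (hp2 : p ≠ 2) {q : ℕ} (hq : q.Coprime (2 * p)) (ε : (𝓞 K)ˣ)
    (m : ℤ) (t : ℕ) :
    ∃ s : (𝓞 K)ˣ, gal p K ((-1) ^ t) (punit hζ ε m) = punit hζ ε m * punit hζ s 0 ^ q := by
  rcases Nat.even_or_odd t with ht | ht
  · refine ⟨1, ?_⟩
    rw [ht.neg_one_pow, gal_one, AlgEquiv.one_apply]
    unfold punit
    simp
  · rw [ht.neg_one_pow]
    exact exists_gal_neg_one_punit hζ hp2 hq ε m

/-! ### The coordinate package -/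

section Package

variable {g : ℕ} [NeZero g] (hg : p - 1 = 2 * g)

include hg in
/-- **Coordinates of `p`-units modulo `q`-th powers** ([Schoof2009, Proposition 13.7] repackaged).
For `p` odd, `p - 1 = 2g`, and a prime `q ≠ 2, p` with `q ∤ g` there are a generator `γ` of `(ℤ/p)ˣ`,
a `p`-unit `u = ε₀ π^{k₀}` and a map `crd : (ε, m) ↦ 𝔽_q^{ℤ/g}` such that
(i) `ε π^m = ∏_k σ_{γ^k}(u)^{crd_k(ε,m)} · (ε' π^{m'})^q` for some `p`-unit `ε' π^{m'}`, and
(ii) any such representation `ε π^m = ∏_k σ_{γ^k}(u)^{c_k} · (ε' π^{m'})^q` has `c_k ≡ crd_k (mod q)`.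
[cite: Schoof2009, Proposition 13.7] -/
theorem exists_crd (hp2 : p ≠ 2) {q : ℕ} [hq : Fact q.Prime] (hq2 : q ≠ 2) (hqp : q ≠ p)
    (hqg : ¬ q ∣ g) :
    ∃ (γ : (ZMod p)ˣ) (ε₀ : (𝓞 K)ˣ) (k₀ : ℤ) (crd : (𝓞 K)ˣ → ℤ → ZMod g → ZMod q),
      (∀ x, x ∈ Subgroup.zpowers γ) ∧
      (∀ (ε : (𝓞 K)ˣ) (m : ℤ), ∃ (ε' : (𝓞 K)ˣ) (m' : ℤ),
        punit hζ ε m = (∏ k : ZMod g, (gal p K (γ ^ k.val) (punit hζ ε₀ k₀)) ^ (crd ε m k).val) *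
          (punit hζ ε' m') ^ q) ∧
      (∀ (ε : (𝓞 K)ˣ) (m : ℤ) (c : ZMod g → ℕ) (ε' : (𝓞 K)ˣ) (m' : ℤ),
        punit hζ ε m = (∏ k : ZMod g, (gal p K (γ ^ k.val) (punit hζ ε₀ k₀)) ^ (c k)) *
          (punit hζ ε' m') ^ q → ∀ k, (c k : ZMod q) = crd ε m k) := by
  classical
  obtain ⟨γ, ε₀, k₀, hγ, hrep, huniq⟩ := exists_free_generator hζ hg hp2 hq2 hqp hqg
  -- choose a representation for every `(ε, m)` and reduce its exponents modulo `q`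
  choose c ε' m' hc using hrep
  refine ⟨γ, ε₀, k₀, fun ε m k => (c ε m k : ZMod q), hγ, fun ε m => ?_, fun ε m d δ' n' hd k => ?_⟩
  · -- `∏ B_k^{c_k} = ∏ B_k^{c_k % q} · (∏ B_k^{c_k / q})^q`
    set B : ZMod g → K := fun k => gal p K (γ ^ k.val) (punit hζ ε₀ k₀) with hB
    have hsplit : ∏ k, B k ^ c ε m k = (∏ k, B k ^ (c ε m k % q)) * (∏ k, B k ^ (c ε m k / q)) ^ q := by
      rw [← Finset.prod_pow Finset.univ q fun k => B k ^ (c ε m k / q), ← Finset.prod_mul_distrib]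
      refine Finset.prod_congr rfl fun k _ => ?_
      rw [← pow_mul, ← pow_add, Nat.mod_add_div']
    -- the quotient part is a `p`-unit
    have hQ := prod_gal_punit_pow hζ Finset.univ (fun k : ZMod g => γ ^ k.val) (fun _ => ε₀)
      (fun _ => k₀) (fun k => c ε m k / q)
    refine ⟨(∏ k, (unitsGal (gal p K (γ ^ k.val)) ε₀ * uσ hζ (γ ^ k.val) ^ k₀) ^ (c ε m k / q)) * ε' ε m,
      (∑ k, ((c ε m k / q : ℕ) : ℤ) * k₀) + m' ε m, ?_⟩
    have hval : (∏ k, B k ^ (c ε m k % q)) = ∏ k, B k ^ ((c ε m k : ZMod q)).val :=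
      Finset.prod_congr rfl fun k _ => by rw [ZMod.val_natCast]
    rw [punit_mul, ← hQ, mul_pow, hc ε m, hsplit, hval, mul_assoc]
  · -- uniqueness: compare with the chosen representation
    set B : ZMod g → K := fun k => gal p K (γ ^ k.val) (punit hζ ε₀ k₀) with hB
    have hB0 : ∀ k, B k ≠ 0 := fun k => by
      rw [hB]
      exact (map_ne_zero_iff _ (gal p K _).injective).mpr
        (mul_ne_zero (coe_unit_ne_zero ε₀) (zpow_ne_zero _ (piK_ne_zero hζ)))
    have h1 : (∏ k, B k ^ d k) * punit hζ δ' n' ^ q = (∏ k, B k ^ c ε m k) * punit hζ (ε' ε m) (m' ε m) ^ q := by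
      rw [← hd, ← hc ε m]
    -- multiply by `∏ B^{(q-1) c}`: `∏ B^{d + (q-1)c} · (δ')^q = (∏ B^c · ε')^q`
    have h2 : (∏ k, B k ^ (d k + (q - 1) * c ε m k)) * punit hζ δ' n' ^ q =
        ((∏ k, B k ^ c ε m k) * punit hζ (ε' ε m) (m' ε m)) ^ q := by
      have hq1 : 1 ≤ q := hq.out.one_lt.le
      calc (∏ k, B k ^ (d k + (q - 1) * c ε m k)) * punit hζ δ' n' ^ q
          = (∏ k, B k ^ ((q - 1) * c ε m k)) * ((∏ k, B k ^ d k) * punit hζ δ' n' ^ q) := by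
            rw [← mul_assoc, ← Finset.prod_mul_distrib]
            congr 1
            exact Finset.prod_congr rfl fun k _ => by rw [← pow_add, add_comm]
        _ = (∏ k, B k ^ ((q - 1) * c ε m k)) * ((∏ k, B k ^ c ε m k) * punit hζ (ε' ε m) (m' ε m) ^ q) := by
            rw [h1]
        _ = ((∏ k, B k ^ c ε m k) * punit hζ (ε' ε m) (m' ε m)) ^ q := by
            rw [mul_pow, ← mul_assoc, ← Finset.prod_mul_distrib, ← Finset.prod_pow]
            congr 1
            refine Finset.prod_congr rfl fun k _ => ?_
            rw [← pow_add, ← pow_mul, mul_comm (c ε m k) q]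
            congr 1
            have : (q - 1) * c ε m k + c ε m k = q * c ε m k := by
              rw [Nat.sub_one_mul, Nat.sub_add_cancel (Nat.le_mul_of_pos_left _ hq.out.pos)]
            exact this
    -- the right-hand side is the `q`-th power of a `p`-unit; divide by `(δ')^q`
    have hP := prod_gal_punit_pow hζ Finset.univ (fun k : ZMod g => γ ^ k.val) (fun _ => ε₀)
      (fun _ => k₀) (c ε m)
    have h3 : ∏ k, B k ^ (d k + (q - 1) * c ε m k) =
        punit hζ (((∏ k, (unitsGal (gal p K (γ ^ k.val)) ε₀ * uσ hζ (γ ^ k.val) ^ k₀) ^ c ε m k) *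
          ε' ε m) * δ'⁻¹) ((∑ k, ((c ε m k : ℕ) : ℤ) * k₀) + m' ε m - n') ^ q := by
      have hne : punit hζ δ' n' ^ q ≠ 0 :=
        pow_ne_zero _ (mul_ne_zero (coe_unit_ne_zero δ') (zpow_ne_zero _ (piK_ne_zero hζ)))
      apply mul_right_cancel₀ hne
      rw [h2, hP, ← punit_mul, ← mul_pow, ← punit_mul]
      congr 2
      · rw [inv_mul_cancel_right]
      · ring
    have h4 := huniq (fun k => d k + (q - 1) * c ε m k) _ _ h3 k
    -- `q ∣ d k + (q-1) c k` gives `d k ≡ c k (mod q)`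
    change (d k : ZMod q) = (c ε m k : ZMod q)
    have h5 : ((d k + (q - 1) * c ε m k : ℕ) : ZMod q) = 0 := (ZMod.natCast_eq_zero_iff _ _).mpr h4
    have hq1 : ((q - 1 : ℕ) : ZMod q) = -1 := by
      rw [Nat.cast_sub hq.out.one_lt.le, Nat.cast_one, ZMod.natCast_self, zero_sub]
    rw [Nat.cast_add, Nat.cast_mul, hq1, neg_one_mul, ← sub_eq_add_neg, sub_eq_zero] at h5
    exact h5

end Package

/-! ### Consequences of the two defining properties -/

section Derived

variable {g : ℕ} [NeZero g] {q : ℕ} [hq : Fact q.Prime]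
variable {γ : (ZMod p)ˣ} {ε₀ : (𝓞 K)ˣ} {k₀ : ℤ} {crd : (𝓞 K)ˣ → ℤ → ZMod g → ZMod q}
variable
  (hrep : ∀ (ε : (𝓞 K)ˣ) (m : ℤ), ∃ (ε' : (𝓞 K)ˣ) (m' : ℤ),
    punit hζ ε m = (∏ k : ZMod g, (gal p K (γ ^ k.val) (punit hζ ε₀ k₀)) ^ (crd ε m k).val) *
      (punit hζ ε' m') ^ q)
  (huniq : ∀ (ε : (𝓞 K)ˣ) (m : ℤ) (c : ZMod g → ℕ) (ε' : (𝓞 K)ˣ) (m' : ℤ),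
    punit hζ ε m = (∏ k : ZMod g, (gal p K (γ ^ k.val) (punit hζ ε₀ k₀)) ^ (c k)) *
      (punit hζ ε' m') ^ q → ∀ k, (c k : ZMod q) = crd ε m k)

include huniq in
/-- **`crd = 0` for `q`-th powers of `p`-units.** [cite: Schoof2009, Proposition 13.7] -/
theorem crd_eq_zero_of_eq_pow {ε ε' : (𝓞 K)ˣ} {m m' : ℤ} (h : punit hζ ε m = punit hζ ε' m' ^ q) :
    crd ε m = 0 := by
  funext k
  have := huniq ε m (fun _ => 0) ε' m' (by simpa using h) k
  rw [← this, Nat.cast_zero]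
  rfl

include hrep in
/-- **`crd = 0` only for `q`-th powers of `p`-units.** [cite: Schoof2009, Proposition 13.7] -/
theorem exists_eq_pow_of_crd_eq_zero {ε : (𝓞 K)ˣ} {m : ℤ} (h : crd ε m = 0) :
    ∃ (ε' : (𝓞 K)ˣ) (m' : ℤ), punit hζ ε m = punit hζ ε' m' ^ q := by
  obtain ⟨ε', m', h1⟩ := hrep ε m
  refine ⟨ε', m', ?_⟩
  rw [h1]
  simp [h]

include hrep huniq in
/-- **Additivity**: `crd (ε ε' π^{m+m'}) = crd (ε π^m) + crd (ε' π^{m'})`. [cite: Schoof2009, Proposition 13.7] -/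
theorem crd_mul (ε ε' : (𝓞 K)ˣ) (m m' : ℤ) : crd (ε * ε') (m + m') = crd ε m + crd ε' m' := by
  obtain ⟨δ, n, h1⟩ := hrep ε m
  obtain ⟨δ', n', h2⟩ := hrep ε' m'
  funext k
  have h3 : punit hζ (ε * ε') (m + m') =
      (∏ k : ZMod g, (gal p K (γ ^ k.val) (punit hζ ε₀ k₀)) ^ ((crd ε m k).val + (crd ε' m' k).val)) *
        punit hζ (δ * δ') (n + n') ^ q := by
    rw [punit_mul, h1, h2, punit_mul, mul_pow]
    simp_rw [pow_add, Finset.prod_mul_distrib]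
    ring
  have := huniq _ _ _ _ _ h3 k
  rw [← this, Nat.cast_add, ZMod.natCast_zmod_val, ZMod.natCast_zmod_val, Pi.add_apply]

include hrep huniq in
/-- `crd` of powers. [folklore] -/
theorem crd_pow (ε : (𝓞 K)ˣ) (m : ℤ) (n : ℕ) : crd (ε ^ n) (n * m) = n • crd ε m := by
  induction n with
  | zero =>
    rw [pow_zero, Nat.cast_zero, zero_mul, zero_smul]
    exact crd_eq_zero_of_eq_pow hζ huniq (ε' := 1) (m' := 0) (by unfold punit; simp)
  | succ n ih =>
    rw [pow_succ, Nat.cast_succ, add_mul, one_mul, crd_mul hζ hrep huniq, ih, succ_nsmul]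

include huniq in
/-- **Every coordinate vector occurs**: `crd (∏_k σ_{γ^k}(u)^{c_k}) = c (mod q)`.
[cite: Schoof2009, Proposition 13.7] -/
theorem crd_prod_gal (c : ZMod g → ℕ) (k : ZMod g) :
    crd (∏ k : ZMod g, (unitsGal (gal p K (γ ^ k.val)) ε₀ * uσ hζ (γ ^ k.val) ^ k₀) ^ c k)
      (∑ k : ZMod g, (c k : ℤ) * k₀) k = c k := by
  have hP := prod_gal_punit_pow hζ Finset.univ (fun k : ZMod g => γ ^ k.val) (fun _ => ε₀)
    (fun _ => k₀) c
  have := huniq _ _ c 1 0 (by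
    rw [← hP]
    have : punit hζ (1 : (𝓞 K)ˣ) 0 = 1 := by unfold punit; simp
    rw [this, one_pow, mul_one]) k
  exact this.symm

variable (hg : p - 1 = 2 * g) (hγ : ∀ x, x ∈ Subgroup.zpowers γ)

include hζ hg hγ hrep huniq in
/-- **The Galois action on coordinates is the regular representation of `ℤ/g`**: for `a = γ^j`,
`crd_k(σ_a(ε π^m)) = crd_{k-j}(ε π^m)` — `σ_{γ^j}` permutes the basis `σ_{γ^k}(u)` cyclically up to
`q`-th powers (`σ_{γ^{k+g}} = ι σ_{γ^k}` and `ι` acts trivially modulo `q`-th powers).  In particular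
`crd(ι(ε π^m)) = crd(ε π^m)`. [cite: Schoof2009, Proposition 13.7 (proof) and Lemma 7.1 (ii)] -/
theorem crd_gal (hp2 : p ≠ 2) (hq2 : q ≠ 2) (hqp : q ≠ p) (j : ℕ) (ε : (𝓞 K)ˣ) (m : ℤ) (k : ZMod g) :
    crd (unitsGal (gal p K (γ ^ j)) ε * uσ hζ (γ ^ j) ^ m) m k = crd ε m (k - (j : ZMod g)) := by
  classical
  have hqcop : q.Coprime (2 * p) := by
    rw [Nat.coprime_mul_iff_right]
    exact ⟨(Nat.coprime_primes hq.out Nat.prime_two).mpr hq2, (Nat.coprime_primes hq.out hp.out).mpr hqp⟩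
  set B : ZMod g → K := fun k => gal p K (γ ^ k.val) (punit hζ ε₀ k₀) with hB
  -- `σ_{γ^j} B_k = B_{k+j} · W_k^q`
  have hshift : ∀ k : ZMod g, ∃ W : (𝓞 K)ˣ,
      gal p K (γ ^ j) (B k) = B (k + j) * punit hζ W 0 ^ q := by
    intro k
    -- `γ^{j + k.val} = γ^{(k+j).val} (γ^g)^t = γ^{(k+j).val} (-1)^t`
    set t : ℕ := (k.val + j) / g with ht
    have hval : k.val + j = (k + (j : ZMod g)).val + g * t := by
      rw [ht, ZMod.val_add, ZMod.val_natCast, Nat.add_mod_mod, Nat.mod_add_div]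
    have hγpow : γ ^ j * γ ^ k.val = γ ^ (k + (j : ZMod g)).val * (-1) ^ t := by
      rw [← pow_add, add_comm, hval, pow_add, pow_mul, gen_pow hg hγ]
    obtain ⟨s, hs⟩ := exists_gal_neg_one_pow_punit hζ hp2 hqcop ε₀ k₀ t
    refine ⟨unitsGal (gal p K (γ ^ (k + (j : ZMod g)).val)) s, ?_⟩
    rw [hB]
    change gal p K (γ ^ j) (gal p K (γ ^ k.val) (punit hζ ε₀ k₀)) = _
    rw [← AlgEquiv.mul_apply, ← gal_mul, hγpow, gal_mul, AlgEquiv.mul_apply, hs, map_mul, map_pow,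
      gal_punit hζ (γ ^ (k + (j : ZMod g)).val) s 0, zpow_zero, mul_one]
  choose W hW using hshift
  -- represent `ε π^m`, apply `σ_{γ^j}` and reindex
  obtain ⟨δ, n, h1⟩ := hrep ε m
  have h2 : gal p K (γ ^ j) (punit hζ ε m) =
      (∏ k : ZMod g, B k ^ (crd ε m (k - j)).val) *
        punit hζ ((∏ k, W k ^ (crd ε m k).val) * (unitsGal (gal p K (γ ^ j)) δ * uσ hζ (γ ^ j) ^ n))
          (0 + n) ^ q := by
    rw [h1, map_mul, map_pow, map_prod, gal_punit, punit_mul, mul_pow, ← mul_assoc]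
    congr 1
    -- `∏ σ(B_k)^{c_k} = ∏ B_{k+j}^{c_k} · (∏ W_k^{c_k})^q`
    have h3 : ∏ k, gal p K (γ ^ j) (B k ^ (crd ε m k).val) =
        (∏ k, B (k + j) ^ (crd ε m k).val) * (∏ k, punit hζ (W k) 0 ^ (crd ε m k).val) ^ q := by
      rw [← Finset.prod_pow, ← Finset.prod_mul_distrib]
      refine Finset.prod_congr rfl fun k _ => ?_
      rw [map_pow, hW, mul_pow, ← pow_mul, ← pow_mul, mul_comm q]
    rw [h3]
    congr 1
    · exact Fintype.prod_equiv (Equiv.addRight (j : ZMod g)) _ _ fun k => by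
        simp only [Equiv.coe_addRight, add_sub_cancel_right]
    · congr 1
      simp_rw [punit_pow, mul_zero]
      rw [punit_prod, Finset.sum_const_zero]
  rw [gal_punit] at h2
  have := huniq _ _ (fun k => (crd ε m (k - j)).val) _ _ h2 k
  rw [← this, ZMod.natCast_zmod_val]

include hζ hg hγ hrep huniq in
/-- **`ι` acts trivially on coordinates** (`ι = σ_{γ^g}` shifts by `g ≡ 0`).
[cite: Schoof2009, Lemma 7.1 (ii)] -/
theorem crd_gal_neg_one (hp2 : p ≠ 2) (hq2 : q ≠ 2) (hqp : q ≠ p) (ε : (𝓞 K)ˣ) (m : ℤ) :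
    crd (unitsGal (gal p K (-1)) ε * uσ hζ (-1) ^ m) m = crd ε m := by
  funext k
  have h := crd_gal hζ hrep huniq hg hγ hp2 hq2 hqp g ε m k
  rw [gen_pow hg hγ] at h
  rw [h, ZMod.natCast_self, sub_zero]

end Derived

end Catalan.Coord

end Literature.NumberTheory.DiophantineGeometry
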